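import Mathlib
import HarnessLib
import Summits.HubbardSuperconductivity.HubbardSuperconductivity.Theorems.KLProgrammeKLRegimeWickSecondOrder

/-!
# Route `KLProgramme` — crux K3, gen-4 ENGINE child `KLRegimeEngineV12` (stmt-HubbardSuperconductivity-19855), (E2-v8):
# ITERATED CROSS CONTRACTIONS and the KERNELS OF A FOLD (cell gate-hubbard-kl, seat p1 g8; sequel to p483614 / p484175)

Two Feynman-rule-level facts for the Wick-ordered step (HOME/p1/E2-STRUCTURE-NOTE.md §4):

* §1 **`grassmannLaplacian_crossCov_sq_copy_mul_copy`** — the DOUBLE cross contraction (the bubble generator):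
  `Δ_×² (a⁰·b¹) = −Σ_{X,Y,X',Y'} contr C X Y · contr C X' Y' • (∂_{X'}∂_X a)⁰ · (∂_{Y'}∂_Y b)¹` for ALL `a, b`
  (iterate the single-contraction formula of p483614; `involute ∘ ∂ ∘ involute ∘ ∂ = −∂∂`);
* §2 **`kernel_dblFold`** — `kernel (dblFold F) m X = Σ_{s : Fin m → Fin 2} kernel F m (fun i => (X i, s i))`: a leg of the folded
  element comes from either copy (the tensor power of the fold matrix `P X (Y,t) = [X = Y]`);
* §3 **`constPart_iterDeriv_iterDeriv_copy_mul_copy`** — the block product rule (Feynman rule for the legs of a two-copy product):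
  `constPart (∂_{X̃} ∂_{Ỹ} (a⁰·b¹)) = (−1)^{m₀m₁} constPart (∂_X a) · constPart (∂_Y b)` (`X̃ = (·,0)∘X`, `Ỹ = (·,1)∘Y`), with the
  lemmas `iterDeriv_involute` (`∂_X ∘ involute = (−1)^m involute ∘ ∂_X`), `iterDeriv_dblCopy`, `iterDeriv_copyOne_mul`,
  `iterDeriv_copyZero_mul`, `constPart_involute`, `constPart_dblCopy`.

Everything is generic (commutative `ℚ`-algebra `R`, finite labels) and proved; no definitions; nothing about the model is asserted.
-/

noncomputable section

namespace Summit.HubbardSuperconductivity.HubbardSuperconductivity.Theorems.KLRegimeWick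

set_option linter.dupNamespace false -- summit = problem name (single-conjunct summit), D-0017

open Literature.MathematicalPhysics.QuantumLattice GrassmannAlgebra Finset Matrix

section Generic

variable (R : Type*) [CommRing R] [Algebra ℚ R] {Γ : Type*} [Fintype Γ] [DecidableEq Γ]

/-! ## §1 Iterated cross contractions -/

omit [Fintype Γ] [DecidableEq Γ] [Algebra ℚ R] in
/-- `involute (∂_X (involute a)) = −∂_X a`. -/
theorem involute_grassmannDeriv_involute {Γ' : Type*} (X : Γ') (a : GrassmannAlgebra R Γ') :
    CliffordAlgebra.involute (grassmannDeriv R X (CliffordAlgebra.involute a)) = -grassmannDeriv R X a := by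
  rw [grassmannDeriv_involute, map_neg, CliffordAlgebra.involute_involute]

/-- **The double cross contraction**: for all `a, b`,
`Δ_{crossCov C}² (dblCopy 0 a · dblCopy 1 b) = −Σ_X Σ_Y Σ_X' Σ_Y' (contr C X Y · contr C X' Y') •
(dblCopy 0 (∂_{X'} ∂_X a) · dblCopy 1 (∂_{Y'} ∂_Y b))`. -/
theorem grassmannLaplacian_crossCov_sq_copy_mul_copy (C : Matrix Γ Γ R) (a b : GrassmannAlgebra R Γ) :
    grassmannLaplacian R (crossCov R C) (grassmannLaplacian R (crossCov R C) (dblCopy R 0 a * dblCopy R 1 b)) =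
      -∑ X, ∑ Y, ∑ X', ∑ Y', (contr R C X Y * contr R C X' Y') •
        (dblCopy R 0 (grassmannDeriv R X' (grassmannDeriv R X a)) *
          dblCopy R 1 (grassmannDeriv R Y' (grassmannDeriv R Y b))) := by
  rw [grassmannLaplacian_crossCov_copy_mul_copy, map_sum]
  simp only [map_sum, map_smul, grassmannLaplacian_crossCov_copy_mul_copy, involute_grassmannDeriv_involute, map_neg,
    neg_mul, smul_neg, Finset.sum_neg_distrib, smul_sum, smul_smul]

/-! ## §2 Kernels of a fold -/

omit [Fintype Γ] [Algebra ℚ R] in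
/-- The tensor power of the fold matrix is the indicator of «same first components». -/
theorem prod_dblProjMat_eq_ite {m : ℕ} (X : Fin m → Γ) (Z : Fin m → Γ × Fin 2) :
    (∏ i, dblProjMat R (Γ := Γ) (X i) (Z i)) = if ∀ i, X i = (Z i).1 then 1 else 0 := by
  simp only [dblProjMat, Matrix.of_apply]
  rw [Finset.prod_ite_zero]
  simp

/-- **`kernel_dblFold`** — the kernels of a folded element: each leg is read in either copy,
`kernel (dblFold F) m X = Σ_{s : Fin m → Fin 2} kernel F m (fun i => (X i, s i))`. -/
theorem kernel_dblFold (F : GrassmannAlgebra R (Γ × Fin 2)) (m : ℕ) (X : Fin m → Γ) :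
    kernel R (dblFold R F) m X = ∑ s : Fin m → Fin 2, kernel R F m (fun i => (X i, s i)) := by
  rw [dblFold, kernel_map, LinearMap.toMatrix'_toLin']
  simp only [prod_dblProjMat_eq_ite, ite_mul, one_mul, zero_mul]
  rw [← Finset.sum_filter]
  have hset : (Finset.univ.filter fun Z : Fin m → Γ × Fin 2 => ∀ i, X i = (Z i).1) =
      Finset.univ.image (fun s : Fin m → Fin 2 => fun i => (X i, s i)) := by
    ext Z
    simp only [Finset.mem_filter, Finset.mem_univ, true_and, Finset.mem_image]
    constructor
    · intro h
      exact ⟨fun i => (Z i).2, funext fun i => Prod.ext (h i) rfl⟩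
    · rintro ⟨s, rfl⟩ i
      rfl
  rw [hset, Finset.sum_image]
  intro s _ t _ hst
  funext i
  have := congrFun hst i
  simpa using this

/-! ## §3 The block product rule: iterated derivatives of `a⁰ · b¹` -/

omit [Fintype Γ] [DecidableEq Γ] [Algebra ℚ R] in
/-- `constPart ∘ involute = constPart`. -/
theorem constPart_involute {Γ' : Type*} (a : GrassmannAlgebra R Γ') :
    constPart R (CliffordAlgebra.involute a) = constPart R a := by
  suffices h : (constPart R).comp (CliffordAlgebra.involute : GrassmannAlgebra R Γ' →ₐ[R] _) = constPart R from
    AlgHom.congr_fun h a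
  refine ExteriorAlgebra.hom_ext (LinearMap.ext fun v => ?_)
  simp only [LinearMap.comp_apply, AlgHom.toLinearMap_apply, AlgHom.comp_apply]
  rw [involute_ι_eq, map_neg, constPart_ι, neg_zero]

omit [Fintype Γ] [DecidableEq Γ] [Algebra ℚ R] in
/-- **Iterated derivatives anticommute with the parity automorphism**: `∂_X (involute a) = (−1)^{m} involute (∂_X a)` for
`X : Fin m → Γ'`. -/
theorem iterDeriv_involute {Γ' : Type*} : ∀ {m : ℕ} (X : Fin m → Γ') (a : GrassmannAlgebra R Γ'),
    iterDeriv R X (CliffordAlgebra.involute a) = (-1 : R) ^ m • CliffordAlgebra.involute (iterDeriv R X a)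
  | 0, X, a => by simp [iterDeriv]
  | m + 1, X, a => by
    rw [iterDeriv_succ_apply, iterDeriv_succ_apply, grassmannDeriv_involute, map_neg, iterDeriv_involute, pow_succ,
      mul_neg_one, neg_smul]

omit [Algebra ℚ R] in
/-- The copy maps fix the constant part. -/
theorem constPart_dblCopy (s : Fin 2) (a : GrassmannAlgebra R Γ) : constPart R (dblCopy R s a) = constPart R a :=
  constPart_map R _ a

omit [Algebra ℚ R] in
/-- The chain rule for the copy maps, iterated: `∂_{(X,s)∘} (dblCopy s a) = dblCopy s (∂_X a)`. -/
theorem iterDeriv_dblCopy (s : Fin 2) : ∀ {m : ℕ} (X : Fin m → Γ) (a : GrassmannAlgebra R Γ),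
    iterDeriv R (fun i => (X i, s)) (dblCopy R s a) = dblCopy R s (iterDeriv R X a)
  | 0, X, a => by simp [iterDeriv]
  | m + 1, X, a => by
    rw [iterDeriv_succ_apply, iterDeriv_succ_apply, grassmannDeriv_dblCopy, if_pos rfl]
    exact iterDeriv_dblCopy s (fun i => X i.succ) _

omit [Algebra ℚ R] [Fintype Γ] in
/-- Copy-`1` derivatives of `A · B` (`A` on copy `0`, `B` on copy `1`): `∂_{Ỹ} (A·B) = involute^{m}(A) · ∂_{Ỹ} B`. -/
theorem iterDeriv_copyOne_mul : ∀ {m : ℕ} (Y : Fin m → Γ) {A B : GrassmannAlgebra R (Γ × Fin 2)},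
    A ∈ fieldSubalgebra R {p : Γ × Fin 2 | p.2 = 0} → B ∈ fieldSubalgebra R {p : Γ × Fin 2 | p.2 = 1} →
      iterDeriv R (fun i => (Y i, (1 : Fin 2))) (A * B) =
        (CliffordAlgebra.involute^[m] A) * iterDeriv R (fun i => (Y i, (1 : Fin 2))) B
  | 0, Y, A, B, _, _ => by simp [iterDeriv]
  | m + 1, Y, A, B, hA, hB => by
    have h01 : ((Y 0, (1 : Fin 2)) : Γ × Fin 2) ∉ {p : Γ × Fin 2 | p.2 = 0} := by simp
    rw [iterDeriv_succ_apply, iterDeriv_succ_apply, grassmannDeriv_mul,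
      grassmannDeriv_eq_zero_of_mem_fieldSubalgebra R h01 hA, zero_mul, zero_add,
      iterDeriv_copyOne_mul (fun i => Y i.succ) (involute_mem_fieldSubalgebra R hA) (grassmannDeriv_mem_fieldSubalgebra R _ hB),
      Function.iterate_succ_apply]

omit [Algebra ℚ R] [Fintype Γ] in
/-- Copy-`0` derivatives of `A · B` with `B` on copy `1`: `∂_{X̃} (A·B) = (∂_{X̃} A) · B`. -/
theorem iterDeriv_copyZero_mul : ∀ {m : ℕ} (X : Fin m → Γ) (A : GrassmannAlgebra R (Γ × Fin 2))
    {B : GrassmannAlgebra R (Γ × Fin 2)}, B ∈ fieldSubalgebra R {p : Γ × Fin 2 | p.2 = 1} →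
      iterDeriv R (fun i => (X i, (0 : Fin 2))) (A * B) = iterDeriv R (fun i => (X i, (0 : Fin 2))) A * B
  | 0, X, A, B, _ => by simp [iterDeriv]
  | m + 1, X, A, B, hB => by
    have h10 : ((X 0, (0 : Fin 2)) : Γ × Fin 2) ∉ {p : Γ × Fin 2 | p.2 = 1} := by simp
    rw [iterDeriv_succ_apply, iterDeriv_succ_apply, grassmannDeriv_mul_eq_mul_of_mem_right R h10 A hB,
      iterDeriv_copyZero_mul (fun i => X i.succ) _ hB]

omit [Fintype Γ] [DecidableEq Γ] [Algebra ℚ R] in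
/-- `involute^{[m]} = (−1)^m`-twist: on any element, `involute^[m] a` is `a` or `involute a`. -/
theorem involute_iterate_eq {Γ' : Type*} (m : ℕ) (a : GrassmannAlgebra R Γ') :
    CliffordAlgebra.involute^[m] a = if Even m then a else CliffordAlgebra.involute a := by
  induction m with
  | zero => simp
  | succ m ih =>
    rw [Function.iterate_succ_apply', ih]
    by_cases hm : Even m
    · rw [if_pos hm, if_neg (Nat.not_even_iff_odd.2 (Even.add_one hm))]
    · rw [if_neg hm, if_pos (by rcases Nat.not_even_iff_odd.1 hm with ⟨k, hk⟩; exact ⟨k + 1, by omega⟩),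
        CliffordAlgebra.involute_involute]

omit [Algebra ℚ R] in
/-- **The block product rule**: for `X : Fin m₀ → Γ`, `Y : Fin m₁ → Γ` and any `a, b`,
`constPart (∂_{X̃} ∂_{Ỹ} (dblCopy 0 a · dblCopy 1 b)) = (−1)^{m₀ m₁} · constPart (∂_X a) · constPart (∂_Y b)`
(`X̃ i = (X i, 0)`, `Ỹ i = (Y i, 1)`; `∂_X` = `iterDeriv X`).  With `kernel F m Z = (m!)⁻¹ constPart (∂_Z F)` and `kernel_dblFold` this is the
Feynman rule for the legs of a two-copy product. -/
theorem constPart_iterDeriv_iterDeriv_copy_mul_copy {m₀ m₁ : ℕ} (X : Fin m₀ → Γ) (Y : Fin m₁ → Γ)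
    (a b : GrassmannAlgebra R Γ) :
    constPart R (iterDeriv R (fun i => (X i, (0 : Fin 2)))
      (iterDeriv R (fun i => (Y i, (1 : Fin 2))) (dblCopy R 0 a * dblCopy R 1 b))) =
      (-1 : R) ^ (m₀ * m₁) * constPart R (iterDeriv R X a) * constPart R (iterDeriv R Y b) := by
  have hpar : ¬Even m₁ → (-1 : R) ^ (m₀ * m₁) = (-1) ^ m₀ := by
    intro hm
    obtain ⟨k, hk⟩ := Nat.not_even_iff_odd.1 hm
    rw [hk, show m₀ * (2 * k + 1) = 2 * (m₀ * k) + m₀ by ring, pow_add, pow_mul, neg_one_sq, one_pow, one_mul]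
  rw [iterDeriv_copyOne_mul R Y (dblCopy_mem_fieldSubalgebra R 0 a) (dblCopy_mem_fieldSubalgebra R 1 b), iterDeriv_dblCopy,
    iterDeriv_copyZero_mul R X _ (dblCopy_mem_fieldSubalgebra R 1 _), map_mul, constPart_dblCopy, involute_iterate_eq]
  by_cases hm : Even m₁
  · rw [if_pos hm, iterDeriv_dblCopy, constPart_dblCopy, Even.neg_one_pow (hm.mul_left m₀), one_mul]
  · rw [if_neg hm, involute_dblCopy, iterDeriv_dblCopy, constPart_dblCopy, iterDeriv_involute, map_smul, constPart_involute,
      smul_eq_mul, hpar hm]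

end Generic

end Summit.HubbardSuperconductivity.HubbardSuperconductivity.Theorems.KLRegimeWick

end
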